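import Summits.HubbardSuperconductivity.HubbardLadder.Bounds.TwistInsensitivityHolder
import HarnessLib

/-!
# No stiffness above `T = 160(|t|+|t'|)` in the THERMODYNAMIC LIMIT — the `L → ∞` form of
# bounds.tex Theorem 12 (v) for the typed class (pub-hubbard BOUNDS)

HONEST FRAMING (cell pub-hubbard): ladder R1–R4 with certified numbers; no claim on H/H₀; bounds for
model classes, no materials claim. This file is a BOUND FOR A MODEL CLASS (the seam-twisted,
translation-invariant on-site `t–t'` Hubbard torus `hubbardTorusTT'FluxMu L t' U μ θ` in the
grand-canonical ensemble at temperature `T ≥ 160(|t|+|t'|)`, units `t = 1`); it makes no materials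
claim. LEAN FILING REQUEST #202 (bounds g26); imports #198.4 (`TwistInsensitivityHolder`).

## What is proved (no `sorry`)

#198.4 proves the finite-volume nodes `HighTemperatureTwistInsensitivityTT'At160` and (with #181.1)
`HighTemperatureNoThermalStiffnessTT'At160`: for every `L ≥ 3`, all real `t', U, μ`, every `β > 0`
with `β(1+|t'|) ≤ 1/160` and every seam twist `θ`,
`|log Re Z_L(0) - log Re Z_L(θ)| ≤ 2·0.377·L²·e^{-L/1000}` and every flux stiffness `ρ_s` of the
grand-canonical free energy on `|θ| ≤ θ₀` obeys `ρ_s ≤ 2·0.377·L²·e^{-L/1000}/(β θ₀²)`.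
Here the elementary limit `C L² e^{-bL} → 0` (`b > 0`; Mathlib's
`Real.tendsto_pow_mul_exp_neg_atTop_nhds_zero` rescaled) is taken, giving the THERMODYNAMIC-LIMIT
statements in `ε–L₀` form with `L₀` depending on `ε` ONLY — i.e. uniformly in `t', U, μ, θ` and in
`β` inside the window `β(1+|t'|) ≤ 1/160`:

* `HighTemperatureTwistInsensitivityTT'At160TL` (proved): `∀ ε > 0 ∃ L₀ ≥ 3 ∀ L ≥ L₀`, for all
  `t', U, μ`, all `β > 0` with `β(1+|t'|) ≤ 1/160` and all `θ`: `|log Re Z_L(0) - log Re Z_L(θ)| ≤ ε`;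
* `HighTemperatureNoThermalStiffnessTT'At160TL` (proved): `∀ ε > 0 ∃ L₀ ≥ 3 ∀ L ≥ L₀`, for all
  `t', U, μ`, all `β > 0` with `β(1+|t'|) ≤ 1/160`, all `θ₀ > 0` and every `ρ_s` with
  `β ρ_s θ² ≤ log Re Z_L(0) - log Re Z_L(θ)` on `|θ| ≤ θ₀`: `ρ_s ≤ ε/(β θ₀²)` — equivalently
  `β θ₀² ρ_s ≤ ε`: NO thermal phase stiffness of the grand-canonical free energy survives the
  thermodynamic limit at any temperature `T ≥ 160(|t|+|t'|)`, uniformly in the on-site repulsion `U`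
  and the chemical potential `μ`.

Compared with #181.7 (`…ClusterTL`, window `65² e⁶ β(2+2|t'|) ≤ 1/2`, i.e. `T ≳ 6.8·10⁶(1+|t'|)`),
the window here is the paper's `T ≥ 160(|t|+|t'|)` (bounds.tex Theorem 12 (iv)–(v)), reached through
the occupation-basis path expansion of #198.1–.4.

Honest limits: grand-canonical ensemble (the canonical sectors are #191's); translation-invariant
on-site data `U, μ` (the paper's class `𝓗_os(t,t')` allows site-dependent on-site terms — not typed
here); seam twist (gauge-equivalent to the uniform twist `θ/L` per bond by #181.2); `η = 0` (no
complex twist, so no curvature statement (iii)).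

References: [KoteckyPreiss1986] Thm p. 492; [Ueltschi1999] §2.3, §3 (arXiv:cond-mat/9810320);
[ScalapinoWhiteZhang1993] (flux / superfluid weight); bounds.tex §12.
-/

noncomputable section

namespace Summit.HubbardSuperconductivity.HubbardLadder.Bounds

open Filter Topology Matrix Literature.MathematicalPhysics.QuantumLattice

/-- `C · L² · e^{-bL} → 0` along the naturals for `b > 0`.
[Mathlib `Real.tendsto_pow_mul_exp_neg_atTop_nhds_zero`, rescaled by `L ↦ bL`] -/
theorem tendsto_const_mul_sq_mul_exp_neg_mul (C : ℝ) {b : ℝ} (hb : 0 < b) :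
    Tendsto (fun L : ℕ => C * (L : ℝ) ^ 2 * Real.exp (-(b * L))) atTop (𝓝 0) := by
  have hbL : Tendsto (fun L : ℕ => b * (L : ℝ)) atTop atTop :=
    tendsto_natCast_atTop_atTop.const_mul_atTop hb
  have h := ((Real.tendsto_pow_mul_exp_neg_atTop_nhds_zero 2).comp hbL).const_mul (C / b ^ 2)
  rw [mul_zero] at h
  convert h using 1
  funext L
  simp only [Function.comp_apply]
  field_simp

/-- For every `ε > 0` there is `L₀ ≥ 3` with `2·0.377·L²·e^{-L/1000} ≤ ε` for all `L ≥ L₀`.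
[this file] -/
theorem exists_forall_at160Bound_le {ε : ℝ} (hε : 0 < ε) :
    ∃ L₀ : ℕ, 3 ≤ L₀ ∧ ∀ L : ℕ, L₀ ≤ L →
      2 * (377 / 1000) * (L : ℝ) ^ 2 * Real.exp (-(1 / 1000 * L)) ≤ ε := by
  have h := tendsto_const_mul_sq_mul_exp_neg_mul (2 * (377 / 1000)) (b := 1 / 1000) (by norm_num)
  rw [Metric.tendsto_atTop] at h
  obtain ⟨N, hN⟩ := h ε hε
  refine ⟨max N 3, le_max_right _ _, fun L hL => ?_⟩
  have hd := hN L (le_trans (le_max_left _ _) hL)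
  rw [Real.dist_eq, sub_zero, abs_of_nonneg (by positivity)] at hd
  exact hd.le

/-! ### Nodes (thermodynamic-limit form, window `T ≥ 160(|t|+|t'|)`) -/

/-- **Node (PROVED below): twist insensitivity in the thermodynamic limit at `T ≥ 160(|t|+|t'|)`.**
For every `ε > 0` there is `L₀ ≥ 3` (depending on `ε` only) such that for all `L ≥ L₀`, all real
`t', U, μ`, every `β > 0` with `β(1+|t'|) ≤ 1/160` and every seam twist `θ`:
`|log Re Z_L(0) - log Re Z_L(θ)| ≤ ε`, `Z_L(θ) = partitionFn β (hubbardTorusTT'FluxMu L t' U μ θ)`.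
[programme node: bounds.tex §12 Thm 12 (i)/(iv)/(v), L → ∞; cites KoteckyPreiss1986, Ueltschi1999] -/
@[conjecture] def HighTemperatureTwistInsensitivityTT'At160TL : Prop :=
  ∀ ε : ℝ, 0 < ε → ∃ L₀ : ℕ, 3 ≤ L₀ ∧ ∀ (L : ℕ) [NeZero L], L₀ ≤ L → ∀ (t' U μ β θ : ℝ),
    0 < β → β * (1 + |t'|) ≤ 1 / 160 →
      |Real.log (partitionFn β (hubbardTorusTT'FluxMu L t' U μ 0)).re -
          Real.log (partitionFn β (hubbardTorusTT'FluxMu L t' U μ θ)).re| ≤ ε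

/-- PROOF of the node `HighTemperatureTwistInsensitivityTT'At160TL` (from #198.4's
`highTemperatureTwistInsensitivityTT'At160_holds` and the elementary limit). [this file] -/
theorem highTemperatureTwistInsensitivityTT'At160TL_holds :
    HighTemperatureTwistInsensitivityTT'At160TL := by
  intro ε hε
  obtain ⟨L₀, hL₀3, hL₀⟩ := exists_forall_at160Bound_le hε
  refine ⟨L₀, hL₀3, fun L _ hL t' U μ β θ hβ hT => ?_⟩
  exact (highTemperatureTwistInsensitivityTT'At160_holds L (le_trans hL₀3 hL) t' U μ β hβ hT θ).trans
    (hL₀ L hL)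

/-- **Node (PROVED below): no thermal phase stiffness in the thermodynamic limit at
`T ≥ 160(|t|+|t'|)`, uniformly in `U`, `μ`, `θ₀` and in `β` inside the window.** For every `ε > 0`
there is `L₀ ≥ 3` (depending on `ε` only) such that for all `L ≥ L₀`, all real `t', U, μ`, every
`β > 0` with `β(1+|t'|) ≤ 1/160`, every `θ₀ > 0` and every flux stiffness `ρ_s` of the
grand-canonical free energy (`β ρ_s θ² ≤ log Re Z_L(0) - log Re Z_L(θ)` for `|θ| ≤ θ₀`):
`ρ_s ≤ ε/(β θ₀²)`. [programme node: bounds.tex §12 Thm 12 (ii)/(iv)/(v), L → ∞;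
cites ScalapinoWhiteZhang1993] -/
@[conjecture] def HighTemperatureNoThermalStiffnessTT'At160TL : Prop :=
  ∀ ε : ℝ, 0 < ε → ∃ L₀ : ℕ, 3 ≤ L₀ ∧ ∀ (L : ℕ) [NeZero L], L₀ ≤ L →
    ∀ (t' U μ β ρs θ₀ : ℝ), 0 < β → 0 < θ₀ → β * (1 + |t'|) ≤ 1 / 160 →
      (∀ θ : ℝ, |θ| ≤ θ₀ → β * ρs * θ ^ 2 ≤
          Real.log (partitionFn β (hubbardTorusTT'FluxMu L t' U μ 0)).re -
            Real.log (partitionFn β (hubbardTorusTT'FluxMu L t' U μ θ)).re) →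
      ρs ≤ ε / (β * θ₀ ^ 2)

/-- PROOF of the node `HighTemperatureNoThermalStiffnessTT'At160TL`: choose `L₀` for `ε` and use
the finite-`L` node `HighTemperatureNoThermalStiffnessTT'At160` (#181.1, proved in #198.4).
[this file] -/
theorem highTemperatureNoThermalStiffnessTT'At160TL_holds :
    HighTemperatureNoThermalStiffnessTT'At160TL := by
  intro ε hε
  obtain ⟨L₀, hL₀3, hL₀⟩ := exists_forall_at160Bound_le hε
  refine ⟨L₀, hL₀3, fun L _ hL t' U μ β ρs θ₀ hβ hθ₀ hT hstiff => ?_⟩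
  have hpos : 0 < β * θ₀ ^ 2 := mul_pos hβ (pow_pos hθ₀ 2)
  have h := highTemperatureNoThermalStiffnessTT'At160_holds L (le_trans hL₀3 hL) t' U μ β ρs θ₀
    hβ hθ₀ hT hstiff
  exact h.trans (div_le_div_of_nonneg_right (hL₀ L hL) hpos.le)

end Summit.HubbardSuperconductivity.HubbardLadder.Bounds

end
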